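import Summits.KontsevichZagierPeriods.KontsevichZagierPeriods.Theorems.SoloInformedAlgBoxSplit
import HarnessLib

/-!
# The DEN-calculus over `K`: RULE GRID — subdividing the cube into `Nⁿ` cells

Solo programme `solo-KontsevichZagierPeriods-informed`, session s107: the DEN-calculus of the
cube crux over a coefficient field `K` of real algebraic numbers, step (x-b) of the general
two-dimensional algorithm — the passage from LOCAL to GLOBAL presentability is organised top-down
(presentability of a denominator is not inherited by sub-boxes, but it is assembled from them).

* `soloInformed_scaleMoveR_comp` — composition of two affine rescalings of the same coordinate;
* **RULE COLUMN** `soloInformed_presentableDenK_of_column` — if `Q ∈ K[x]` has no zero on the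
  open cube and each of the `M` slab pieces `Q(…, (k + xᵢ)/M, …)`, `k < M`, is a presentable
  denominator, then so is `Q` (induction on `M`, splitting off the first slab with RULE SPLIT
  `soloInformed_presentableDenK_of_split` at the abscissa `1/M`; the remaining `M − 1` pieces of
  the right part are the pieces `k + 1` of `Q`);
* `soloInformedGridSubstK s N c` / `soloInformedGridMoveR` — the substitution
  `xⱼ ↦ (cⱼ + xⱼ)/N` in the directions `j ∈ s`, and its evaluation formula;
* **RULE GRID** `soloInformed_presentableDenK_of_grid` — if `Q` has no zero on the open cube and
  every cell polynomial `Q((c + x)/N)`, `c ∈ {0, …, N−1}ⁿ`, is a presentable denominator, then so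
  is `Q` (RULE COLUMN in every direction).

All statements are extensional in the values of the denominators on the open cube
(`soloInformed_presentableDenK_congr`), so only VALUE identities of the substitutions are needed.

References: M. Kontsevich, D. Zagier, *Periods* (2001), §1.2 (additivity in the domain);
J. Kollár, *Lectures on Resolution of Singularities* (2007), §1.8.
-/

noncomputable section

open scoped BigOperators
open MeasureTheory Set
open Literature.NumberTheory.Transcendental Literature.NumberTheory.Transcendental.KZ

namespace Summit.KontsevichZagierPeriods.KontsevichZagierPeriods.Theorems

variable {n : ℕ} {K : Type*} [Field K] [Algebra K ℝ]

/-! ### Composition and cube-preservation of scale moves -/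

omit [Algebra K ℝ] in
/-- Composition of two rescalings of the same coordinate:
`Λ_{i,α,β} ∘ Λ_{i,α',β'} = Λ_{i, α + β α', β β'}`. [this work] -/
theorem soloInformed_scaleMoveR_comp (i : Fin n) (α β α' β' : ℝ) (x : Fin n → ℝ) :
    soloInformedScaleMoveR i α β (soloInformedScaleMoveR i α' β' x) =
      soloInformedScaleMoveR i (α + β * α') (β * β') x := by
  funext j
  by_cases hj : j = i
  · subst hj
    simp only [soloInformedScaleMoveR, if_true]
    ring
  · simp only [soloInformedScaleMoveR, if_neg hj]

omit [Algebra K ℝ] in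
/-- `Λ_{i,0,1} = id`. [this work] -/
theorem soloInformed_scaleMoveR_zero_one (i : Fin n) (x : Fin n → ℝ) :
    soloInformedScaleMoveR i 0 1 x = x := by
  funext j
  by_cases hj : j = i
  · subst hj
    simp [soloInformedScaleMoveR]
  · simp [soloInformedScaleMoveR, hj]

omit [Algebra K ℝ] in
/-- For `0 ≤ α`, `0 < β`, `α + β ≤ 1` the scale move maps the open cube into itself. [this work] -/
theorem soloInformed_scaleMoveR_mem_openCube (i : Fin n) {α β : ℝ} (hα : 0 ≤ α) (hβ : 0 < β)
    (hαβ : α + β ≤ 1) {x : Fin n → ℝ} (hx : x ∈ soloInformedOpenCube n) :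
    soloInformedScaleMoveR i α β x ∈ soloInformedOpenCube n :=
  soloInformedSlabR_subset_openCube i α β (soloInformed_scaleMoveR_mem i hα hβ hαβ hx)

/-- The values of a slab piece with parameters `k/M`, `1/M` given in `K`. [this work] -/
theorem soloInformed_aeval_scaleSubstK_natDiv (i : Fin n) (k M : ℕ) (x : Fin n → ℝ)
    (Q : MvPolynomial (Fin n) K) :
    (MvPolynomial.aeval x (soloInformedScaleSubstK i ((k : K) / M) ((M : K)⁻¹) Q) : ℝ) =
      MvPolynomial.aeval (soloInformedScaleMoveR i ((k : ℝ) / M) ((M : ℝ)⁻¹) x) Q := by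
  rw [soloInformed_aeval_scaleSubstK, map_div₀, map_inv₀, map_natCast, map_natCast]

/-! ### RULE COLUMN -/

/-- **RULE COLUMN.**  Over a field `K` of real algebraic numbers: if `Q` has no zero on the open
cube and each slab piece `Q ∘ Λ_{i, k/M, 1/M}` (`k < M`, `M ≥ 1`) is a presentable denominator,
then `Q` is a presentable denominator. [this work] -/
theorem soloInformed_presentableDenK_of_column
    (hK : ∀ c : K, IsAlgebraic ℚ (algebraMap K ℝ c)) (i : Fin n) (M : ℕ) (hM : 0 < M)
    {Q : MvPolynomial (Fin n) K}
    (hQ : ∀ x ∈ soloInformedOpenCube n, (MvPolynomial.aeval x Q : ℝ) ≠ 0)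
    (h : ∀ k < M, SoloInformedPresentableDenK
      (soloInformedScaleSubstK i ((k : K) / M) ((M : K)⁻¹) Q)) :
    SoloInformedPresentableDenK Q := by
  obtain ⟨M, rfl⟩ : ∃ M', M = M' + 1 := ⟨M - 1, (Nat.sub_add_cancel hM).symm⟩
  clear hM
  induction M generalizing Q with
  | zero =>
    -- one piece: `Q ∘ Λ_{i,0,1} = Q`
    refine soloInformed_presentableDenK_congr (fun x _ => ?_) (h 0 Nat.zero_lt_one)
    rw [soloInformed_aeval_scaleSubstK_natDiv]
    simp [soloInformed_scaleMoveR_zero_one]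
  | succ M ih =>
    -- split off the first slab at `c = 1/(M+2)`
    have hM2 : (0 : ℝ) < (M + 2 : ℕ) := by exact_mod_cast Nat.succ_pos (M + 1)
    have hc : algebraMap K ℝ (((M + 2 : ℕ) : K)⁻¹) = ((M + 2 : ℕ) : ℝ)⁻¹ := by
      rw [map_inv₀, map_natCast]
    have hc0 : 0 < algebraMap K ℝ (((M + 2 : ℕ) : K)⁻¹) := by rw [hc]; exact inv_pos.2 hM2
    have hc1 : algebraMap K ℝ (((M + 2 : ℕ) : K)⁻¹) < 1 := by
      rw [hc]; exact inv_lt_one_of_one_lt₀ (by exact_mod_cast Nat.lt_of_sub_eq_succ rfl)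
    refine soloInformed_presentableDenK_of_split hK i (((M + 2 : ℕ) : K)⁻¹) hc0 hc1
      (fun x hx _ => hQ x hx) ?_ ?_
    · -- the first slab is the piece `k = 0`
      refine soloInformed_presentableDenK_congr (fun x _ => ?_) (h 0 (Nat.succ_pos _))
      rw [soloInformed_aeval_scaleSubstK_natDiv, soloInformed_aeval_scaleSubstK, hc, map_zero,
        Nat.cast_zero, zero_div]
    · -- the right part `Q' = Q ∘ Λ_{i,c,1-c}` has the pieces `k + 1` of `Q`
      have hmem : ∀ x ∈ soloInformedOpenCube n,
          soloInformedScaleMoveR i (algebraMap K ℝ (((M + 2 : ℕ) : K)⁻¹))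
            (algebraMap K ℝ (1 - ((M + 2 : ℕ) : K)⁻¹)) x ∈ soloInformedOpenCube n := by
        intro x hx
        rw [map_sub, map_one, hc]
        exact soloInformed_scaleMoveR_mem_openCube i (inv_pos.2 hM2).le
          (by rw [sub_pos]; exact inv_lt_one_of_one_lt₀ (by exact_mod_cast Nat.lt_of_sub_eq_succ rfl))
          (by rw [add_sub_cancel]) hx
      refine ih (fun x hx => ?_) (fun k hk => ?_)
      · rw [soloInformed_aeval_scaleSubstK]
        exact hQ _ (hmem x hx)
      · refine soloInformed_presentableDenK_congr (fun x _ => ?_) (h (k + 1) (by omega))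
        rw [soloInformed_aeval_scaleSubstK_natDiv, soloInformed_aeval_scaleSubstK_natDiv,
          soloInformed_aeval_scaleSubstK, map_sub, map_one, hc, soloInformed_scaleMoveR_comp]
        have hM1 : ((M + 1 : ℕ) : ℝ) ≠ 0 := by exact_mod_cast Nat.succ_ne_zero M
        have eA : ((M + 2 : ℕ) : ℝ)⁻¹ + (1 - ((M + 2 : ℕ) : ℝ)⁻¹) * (((k : ℕ) : ℝ) / ((M + 1 : ℕ) : ℝ)) =
            ((k + 1 : ℕ) : ℝ) / ((M + 2 : ℕ) : ℝ) := by
          push_cast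
          field_simp
          ring
        have eB : (1 - ((M + 2 : ℕ) : ℝ)⁻¹) * ((M + 1 : ℕ) : ℝ)⁻¹ = ((M + 2 : ℕ) : ℝ)⁻¹ := by
          push_cast
          field_simp
          ring
        rw [eA, eB]

/-! ### The grid substitution -/

/-- The **grid move** in the directions `s`: `xⱼ ↦ (cⱼ + xⱼ)/N` for `j ∈ s`, the other coordinates
fixed. [this work] -/
def soloInformedGridMoveR (s : Finset (Fin n)) (N : ℕ) (c : Fin n → ℕ) (x : Fin n → ℝ) :
    Fin n → ℝ :=
  fun j => if j ∈ s then ((c j : ℝ) + x j) / N else x j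

/-- The **grid substitution** in the directions `s`: `xⱼ ↦ cⱼ/N + xⱼ/N` for `j ∈ s`
(coefficients in `K`). [this work] -/
def soloInformedGridSubstK (s : Finset (Fin n)) (N : ℕ) (c : Fin n → ℕ) :
    MvPolynomial (Fin n) K →ₐ[K] MvPolynomial (Fin n) K :=
  MvPolynomial.bind₁ fun j =>
    if j ∈ s then MvPolynomial.C ((c j : K) / N) + MvPolynomial.C ((N : K)⁻¹) * MvPolynomial.X j
    else MvPolynomial.X j

/-- Evaluation of the grid substitution: `(T_{s,N,c} Q)(x) = Q(gridMove x)`. [this work] -/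
theorem soloInformed_aeval_gridSubstK (s : Finset (Fin n)) (N : ℕ) (c : Fin n → ℕ)
    (x : Fin n → ℝ) (Q : MvPolynomial (Fin n) K) :
    (MvPolynomial.aeval x (soloInformedGridSubstK s N c Q) : ℝ) =
      MvPolynomial.aeval (soloInformedGridMoveR s N c x) Q := by
  unfold soloInformedGridSubstK
  rw [MvPolynomial.aeval_bind₁]
  have h : (fun j => (MvPolynomial.aeval x
      (if j ∈ s then MvPolynomial.C ((c j : K) / N) + MvPolynomial.C ((N : K)⁻¹) * MvPolynomial.X j
        else MvPolynomial.X j : MvPolynomial (Fin n) K) : ℝ)) = soloInformedGridMoveR s N c x := by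
    funext j
    by_cases hj : j ∈ s
    · simp only [hj, if_true, map_add, map_mul, MvPolynomial.aeval_C, MvPolynomial.aeval_X,
        map_div₀, map_inv₀, map_natCast, soloInformedGridMoveR]
      ring
    · simp [soloInformedGridMoveR, hj]
  rw [h]

omit [Algebra K ℝ] in
/-- The grid move with `cⱼ < N` maps the open cube into itself. [this work] -/
theorem soloInformed_gridMoveR_mem_openCube (s : Finset (Fin n)) {N : ℕ} {c : Fin n → ℕ}
    (hc : ∀ j, c j < N) {x : Fin n → ℝ} (hx : x ∈ soloInformedOpenCube n) :
    soloInformedGridMoveR s N c x ∈ soloInformedOpenCube n := by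
  intro j
  unfold soloInformedGridMoveR
  split_ifs with hj
  · have hN : (0 : ℝ) < N := by exact_mod_cast lt_of_le_of_lt (Nat.zero_le _) (hc j)
    have hcj : (c j : ℝ) + 1 ≤ N := by exact_mod_cast hc j
    refine ⟨div_pos (add_pos_of_nonneg_of_pos (Nat.cast_nonneg _) (hx j).1) hN, ?_⟩
    rw [div_lt_one hN]
    linarith [(hx j).2]
  · exact hx j

omit [Algebra K ℝ] in
/-- Adding a direction to the grid move: `gridMove_{insert i s} = Λ_{i, cᵢ/N, 1/N} ∘ gridMove_s`
(for `i ∉ s`). [this work] -/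
theorem soloInformed_gridMoveR_insert (s : Finset (Fin n)) {i : Fin n} (hi : i ∉ s) (N : ℕ)
    (c : Fin n → ℕ) (x : Fin n → ℝ) :
    soloInformedGridMoveR (insert i s) N c x =
      soloInformedScaleMoveR i ((c i : ℝ) / N) ((N : ℝ)⁻¹) (soloInformedGridMoveR s N c x) := by
  funext j
  by_cases hj : j = i
  · subst hj
    simp only [soloInformedGridMoveR, Finset.mem_insert, true_or, if_true, if_neg hi,
      soloInformedScaleMoveR]
    ring
  · have h1 : (j ∈ insert i s) ↔ j ∈ s := by simp [Finset.mem_insert, hj]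
    simp only [soloInformedGridMoveR, soloInformedScaleMoveR, if_neg hj]
    by_cases hjs : j ∈ s
    · rw [if_pos (h1.2 hjs), if_pos hjs]
    · rw [if_neg (mt h1.1 hjs), if_neg hjs]

omit [Algebra K ℝ] in
/-- The grid move does not depend on `cᵢ` for `i ∉ s`. [this work] -/
theorem soloInformed_gridMoveR_update (s : Finset (Fin n)) {i : Fin n} (hi : i ∉ s) (N : ℕ)
    (c : Fin n → ℕ) (k : ℕ) (x : Fin n → ℝ) :
    soloInformedGridMoveR s N (Function.update c i k) x = soloInformedGridMoveR s N c x := by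
  funext j
  unfold soloInformedGridMoveR
  split_ifs with hj
  · rw [Function.update_of_ne]
    rintro rfl
    exact hi hj
  · rfl

/-! ### RULE GRID -/

/-- RULE GRID in the directions `s` (induction on `s`). [this work] -/
theorem soloInformed_presentableDenK_of_grid_finset
    (hK : ∀ c : K, IsAlgebraic ℚ (algebraMap K ℝ c)) {N : ℕ} (hN : 0 < N) (s : Finset (Fin n))
    {Q : MvPolynomial (Fin n) K}
    (hQ : ∀ x ∈ soloInformedOpenCube n, (MvPolynomial.aeval x Q : ℝ) ≠ 0)
    (h : ∀ c : Fin n → ℕ, (∀ j, c j < N) →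
      SoloInformedPresentableDenK (soloInformedGridSubstK s N c Q)) :
    SoloInformedPresentableDenK Q := by
  classical
  induction s using Finset.induction_on generalizing Q with
  | empty =>
    refine soloInformed_presentableDenK_congr (fun x _ => ?_) (h (fun _ => 0) fun _ => hN)
    have hx : soloInformedGridMoveR ∅ N (fun _ => 0) x = x := by
      funext j
      simp [soloInformedGridMoveR]
    rw [soloInformed_aeval_gridSubstK, hx]
  | insert i s hi ih =>
    -- RULE COLUMN in the direction `i`, then the induction hypothesis on each slab piece
    refine soloInformed_presentableDenK_of_column hK i N hN hQ fun k hk => ?_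
    have hmemk : ∀ x ∈ soloInformedOpenCube n,
        soloInformedScaleMoveR i ((k : ℝ) / N) ((N : ℝ)⁻¹) x ∈ soloInformedOpenCube n := by
      intro x hx
      have hN' : (0 : ℝ) < N := by exact_mod_cast hN
      refine soloInformed_scaleMoveR_mem_openCube i (div_nonneg (Nat.cast_nonneg _) hN'.le)
        (inv_pos.2 hN') ?_ hx
      have e : (k : ℝ) / N + (N : ℝ)⁻¹ = ((k : ℝ) + 1) / N := by
        field_simp
      rw [e, div_le_one hN']
      exact_mod_cast Nat.succ_le_of_lt hk
    refine ih (fun x hx => ?_) (fun c hc => ?_)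
    · rw [soloInformed_aeval_scaleSubstK_natDiv]
      exact hQ _ (hmemk x hx)
    · -- the `c`-cell of the piece `k` is the `c[i ↦ k]`-cell of `Q`
      have hc' : ∀ j, Function.update c i k j < N := fun j => by
        by_cases hj : j = i
        · subst hj; rwa [Function.update_self]
        · rw [Function.update_of_ne hj]; exact hc j
      refine soloInformed_presentableDenK_congr (fun x _ => ?_) (h _ hc')
      rw [soloInformed_aeval_gridSubstK, soloInformed_aeval_gridSubstK,
        soloInformed_aeval_scaleSubstK_natDiv, soloInformed_gridMoveR_insert s hi,
        soloInformed_gridMoveR_update s hi, Function.update_self]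

/-- **RULE GRID.**  Over a field `K` of real algebraic numbers: if `Q ∈ K[x₁, …, xₙ]` has no zero
on the open cube and, for some `N ≥ 1`, every cell polynomial `Q((c + x)/N)` with
`c ∈ {0, …, N − 1}ⁿ` is a presentable denominator, then `Q` is a presentable denominator.
[this work] -/
theorem soloInformed_presentableDenK_of_grid
    (hK : ∀ c : K, IsAlgebraic ℚ (algebraMap K ℝ c)) {N : ℕ} (hN : 0 < N)
    {Q : MvPolynomial (Fin n) K}
    (hQ : ∀ x ∈ soloInformedOpenCube n, (MvPolynomial.aeval x Q : ℝ) ≠ 0)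
    (h : ∀ c : Fin n → ℕ, (∀ j, c j < N) →
      SoloInformedPresentableDenK (soloInformedGridSubstK Finset.univ N c Q)) :
    SoloInformedPresentableDenK Q :=
  soloInformed_presentableDenK_of_grid_finset hK hN Finset.univ hQ h

omit [Algebra K ℝ] in
/-- The full grid move is `x ↦ (c + x)/N`. [this work] -/
theorem soloInformed_gridMoveR_univ (N : ℕ) (c : Fin n → ℕ) (x : Fin n → ℝ) :
    soloInformedGridMoveR Finset.univ N c x = fun j => ((c j : ℝ) + x j) / N := by
  funext j
  simp [soloInformedGridMoveR]

/-- **RULE GRID, value form.**  If `Q` has no zero on the open cube and for every cell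
`c ∈ {0, …, N−1}ⁿ` some presentable denominator `Q_c` takes the values `Q((c + x)/N)` on the open
cube, then `Q` is a presentable denominator. [this work] -/
theorem soloInformed_presentableDenK_of_grid_values
    (hK : ∀ c : K, IsAlgebraic ℚ (algebraMap K ℝ c)) {N : ℕ} (hN : 0 < N)
    {Q : MvPolynomial (Fin n) K}
    (hQ : ∀ x ∈ soloInformedOpenCube n, (MvPolynomial.aeval x Q : ℝ) ≠ 0)
    (h : ∀ c : Fin n → ℕ, (∀ j, c j < N) → ∃ Qc : MvPolynomial (Fin n) K,
      SoloInformedPresentableDenK Qc ∧ ∀ x ∈ soloInformedOpenCube n,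
        (MvPolynomial.aeval x Qc : ℝ) = MvPolynomial.aeval (fun j => ((c j : ℝ) + x j) / N) Q) :
    SoloInformedPresentableDenK Q := by
  refine soloInformed_presentableDenK_of_grid hK hN hQ fun c hc => ?_
  obtain ⟨Qc, hQc, hval⟩ := h c hc
  refine soloInformed_presentableDenK_congr (fun x hx => ?_) hQc
  rw [hval x hx, soloInformed_aeval_gridSubstK, soloInformed_gridMoveR_univ]

end Summit.KontsevichZagierPeriods.KontsevichZagierPeriods.Theorems
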